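import Mathlib
import Summits.ValiantsHypothesis.ValiantsHypothesis.Theorems.NewtonUnitEquationsDissociatedUniformTotalsLaw
import Literature.Computability.AlgebraicComplexity.NewtonPolygonTauProductBounds
import HarnessLib

/-!
# Crux `NewtonUnitEquations.DissociatedUniform` (stmt-ValiantsHypothesis-5905): totals law — fibre-sum dominance on the degenerate stratum, and the three-system locator

Companion of `…DissociatedUniformTotalsLaw`.  Two small kernel facts asked for by the census / the critic's read:

* **Translation invariance of vertex counts** (`extremePoints_vadd`, `ncard_extremePoints_vadd`) and hence, for a CONSTANT
  third curve `c ≡ c₀`: every class is `c₀ + (A + B)` and the `Q`/`R` fibres are `c₀ + B`, `c₀ + A`, so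
  `T = |G|·V(A+B) ≤ |G|·(V(A) + V(B)) = V_R + V_Q` — `FibreSumDominance` holds with slack `C = 0` on this stratum
  (`totalVert_const_le_fibreTotal`), the census-sharp form of the typed conjecture at its extremisers.
* **Locator** (critic's hint): `T ≤ |G|·min(V_P, V_Q, V_R) + |G|²` (`totalVert_le_card_mul_min`), i.e. the weak law is automatic
  unless ALL THREE pair systems have super-linear fibre totals — hard instances are pairwise convexly entangled triples.
[folklore]
-/

set_option linter.dupNamespace false -- `ValiantsHypothesis.ValiantsHypothesis` (summit = problem) in every name

open scoped BigOperators Pointwise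

namespace Summit.ValiantsHypothesis.ValiantsHypothesis.Theorems.NewtonUnitEquationsDissociatedUniform

namespace TotalsLaw

/-! ### Translation invariance of extreme points -/

section Translate

variable {E : Type*} [AddCommGroup E] [Module ℝ E]

/-- Extreme points commute with translations: `ext(v + A) = v + ext(A)`. [folklore] -/
theorem extremePoints_vadd (v : E) (A : Set E) : (v +ᵥ A).extremePoints ℝ = v +ᵥ A.extremePoints ℝ := by
  ext x
  rw [Set.mem_vadd_set]
  constructor
  · intro hx
    rw [mem_extremePoints] at hx
    obtain ⟨hxA, hext⟩ := hx
    obtain ⟨y, hyA, rfl⟩ := Set.mem_vadd_set.1 hxA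
    refine ⟨y, ?_, rfl⟩
    rw [mem_extremePoints]
    refine ⟨hyA, fun x₁ hx₁ x₂ hx₂ hseg => ?_⟩
    have h1 : v +ᵥ x₁ ∈ v +ᵥ A := Set.vadd_mem_vadd_set hx₁
    have h2 : v +ᵥ x₂ ∈ v +ᵥ A := Set.vadd_mem_vadd_set hx₂
    have hseg' : v +ᵥ y ∈ openSegment ℝ (v +ᵥ x₁) (v +ᵥ x₂) := by
      rw [vadd_eq_add, vadd_eq_add, vadd_eq_add, ← openSegment_translate_preimage ℝ v x₁ x₂] at *
      simpa using hseg
    obtain ⟨e1, e2⟩ := hext _ h1 _ h2 hseg'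
    exact ⟨by simpa using e1, by simpa using e2⟩
  · rintro ⟨y, hy, rfl⟩
    rw [mem_extremePoints] at hy ⊢
    obtain ⟨hyA, hext⟩ := hy
    refine ⟨Set.vadd_mem_vadd_set hyA, fun x₁ hx₁ x₂ hx₂ hseg => ?_⟩
    obtain ⟨y₁, hy₁, rfl⟩ := Set.mem_vadd_set.1 hx₁
    obtain ⟨y₂, hy₂, rfl⟩ := Set.mem_vadd_set.1 hx₂
    have hseg' : y ∈ openSegment ℝ y₁ y₂ := by
      rw [← openSegment_translate_preimage ℝ v y₁ y₂]
      simpa [vadd_eq_add] using hseg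
    obtain ⟨e1, e2⟩ := hext _ hy₁ _ hy₂ hseg'
    exact ⟨by rw [e1], by rw [e2]⟩

/-- Hence translated sets have the same number of hull vertices. [folklore] -/
theorem ncard_extremePoints_vadd (v : E) (S : Set E) :
    ((convexHull ℝ (v +ᵥ S)).extremePoints ℝ).ncard = ((convexHull ℝ S).extremePoints ℝ).ncard := by
  rw [convexHull_vadd, extremePoints_vadd]
  exact Set.ncard_image_of_injective _ (add_right_injective v)

end Translate

variable {G : Type*} [AddCommGroup G] [Fintype G]

/-! ### The degenerate stratum `c ≡ c₀`: exact counts and fibre-sum dominance with slack `0` -/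

omit [Fintype G] in
/-- With a constant third curve every class is the translate `c₀ + (A + B)` of the full pair sumset (set form). [folklore] -/
theorem classPts_const_eq_vadd (a b : G → (Fin 2 → ℝ)) (c₀ : Fin 2 → ℝ) (s : G) :
    classPts a b (fun _ => c₀) s = c₀ +ᵥ (Set.range a + Set.range b) := by
  ext p
  simp only [classPts, Set.mem_range, Prod.exists, Set.mem_vadd_set, Set.mem_add, vadd_eq_add]
  constructor
  · rintro ⟨x, y, rfl⟩
    exact ⟨a x + b y, ⟨a x, ⟨x, rfl⟩, b y, ⟨y, rfl⟩, rfl⟩, by abel⟩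
  · rintro ⟨_, ⟨_, ⟨x, rfl⟩, _, ⟨y, rfl⟩, rfl⟩, rfl⟩
    exact ⟨x, y, by abel⟩

omit [Fintype G] in
/-- With a constant partner the fibre is a translate: `fibrePts b (fun _ => c₀) t = c₀ + B`. [folklore] -/
theorem fibrePts_const_right (b : G → (Fin 2 → ℝ)) (c₀ : Fin 2 → ℝ) (t : G) :
    fibrePts b (fun _ => c₀) t = c₀ +ᵥ Set.range b := by
  ext p
  simp only [fibrePts, Set.mem_range, Set.mem_vadd_set, vadd_eq_add]
  constructor
  · rintro ⟨y, rfl⟩; exact ⟨b y, ⟨y, rfl⟩, by abel⟩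
  · rintro ⟨_, ⟨y, rfl⟩, rfl⟩; exact ⟨y, by abel⟩

omit [Fintype G] in
/-- With a constant partner the fibre is a translate: `fibrePts (fun _ => c₀) a u = c₀ + A`. [folklore] -/
theorem fibrePts_const_left (a : G → (Fin 2 → ℝ)) (c₀ : Fin 2 → ℝ) (u : G) :
    fibrePts (fun _ => c₀) a u = c₀ +ᵥ Set.range a := by
  ext p
  simp only [fibrePts, Set.mem_range, Set.mem_vadd_set, vadd_eq_add]
  constructor
  · rintro ⟨x, rfl⟩; exact ⟨a (u - x), ⟨u - x, rfl⟩, rfl⟩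
  · rintro ⟨_, ⟨x, rfl⟩, rfl⟩; exact ⟨u - x, by rw [sub_sub_cancel]⟩

omit [Fintype G] in
/-- **Exact class count on the degenerate stratum**: `V_s = V(A + B)`. [folklore] -/
theorem classVert_const_eq (a b : G → (Fin 2 → ℝ)) (c₀ : Fin 2 → ℝ) (s : G) :
    classVert a b (fun _ => c₀) s = ((convexHull ℝ (Set.range a + Set.range b)).extremePoints ℝ).ncard := by
  unfold classVert
  rw [classPts_const_eq_vadd, ncard_extremePoints_vadd]

omit [Fintype G] in
/-- `V(Q_t) = V(B)` on the degenerate stratum. [folklore] -/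
theorem fibreVert_const_right (b : G → (Fin 2 → ℝ)) (c₀ : Fin 2 → ℝ) (t : G) :
    fibreVert b (fun _ => c₀) t = ((convexHull ℝ (Set.range b)).extremePoints ℝ).ncard := by
  unfold fibreVert
  rw [fibrePts_const_right, ncard_extremePoints_vadd]

omit [Fintype G] in
/-- `V(R_u) = V(A)` on the degenerate stratum. [folklore] -/
theorem fibreVert_const_left (a : G → (Fin 2 → ℝ)) (c₀ : Fin 2 → ℝ) (u : G) :
    fibreVert (fun _ => c₀) a u = ((convexHull ℝ (Set.range a)).extremePoints ℝ).ncard := by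
  unfold fibreVert
  rw [fibrePts_const_left, ncard_extremePoints_vadd]

/-- The planar Minkowski bound for the two letter sets: `V(A + B) ≤ V(A) + V(B)` (tree lemma, set form). [folklore] -/
theorem ncard_extremePoints_range_add_le (a b : G → (Fin 2 → ℝ)) :
    ((convexHull ℝ (Set.range a + Set.range b)).extremePoints ℝ).ncard ≤
      ((convexHull ℝ (Set.range a)).extremePoints ℝ).ncard + ((convexHull ℝ (Set.range b)).extremePoints ℝ).ncard := by
  classical
  have hA : (Finset.univ.image a : Finset (Fin 2 → ℝ)).Nonempty := ⟨a 0, Finset.mem_image.2 ⟨0, Finset.mem_univ _, rfl⟩⟩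
  have hB : (Finset.univ.image b : Finset (Fin 2 → ℝ)).Nonempty := ⟨b 0, Finset.mem_image.2 ⟨0, Finset.mem_univ _, rfl⟩⟩
  have hcoeA : ((Finset.univ.image a : Finset (Fin 2 → ℝ)) : Set (Fin 2 → ℝ)) = Set.range a := by
    rw [Finset.coe_image, Finset.coe_univ, Set.image_univ]
  have hcoeB : ((Finset.univ.image b : Finset (Fin 2 → ℝ)) : Set (Fin 2 → ℝ)) = Set.range b := by
    rw [Finset.coe_image, Finset.coe_univ, Set.image_univ]
  have h := Literature.Computability.AlgebraicComplexity.KPTT.PlanarMinkowski.ncard_extremePoints_add_le hA hB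
  rwa [Finset.coe_add, hcoeA, hcoeB] at h

/-- **Fibre-sum dominance with slack `0` on the degenerate stratum**: for a constant third curve
`T = |G|·V(A+B) ≤ |G|·V(B) + |G|·V(A) = V_Q + V_R`, i.e. `totalVert a b c ≤ fibreTotal b c + fibreTotal c a` (no `V_P`, no `O(q)`
slack needed) — the census-sharp form of `FibreSumDominance` at its extremisers. [folklore] -/
theorem totalVert_const_le_fibreTotal (a b : G → (Fin 2 → ℝ)) (c₀ : Fin 2 → ℝ) :
    totalVert a b (fun _ => c₀) ≤ fibreTotal b (fun _ => c₀) + fibreTotal (fun _ => c₀) a := by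
  unfold totalVert fibreTotal
  rw [← Finset.sum_add_distrib]
  refine Finset.sum_le_sum fun s _ => ?_
  rw [classVert_const_eq, fibreVert_const_right, fibreVert_const_left]
  exact (ncard_extremePoints_range_add_le a b).trans_eq (Nat.add_comm _ _)

/-- Hence `FibreSumDominance` (any slack) holds for constant third curves:
`T ≤ V_P + V_Q + V_R + C|G|`. [folklore] -/
theorem fibreSumDominance_const (C : ℕ) (a b : G → (Fin 2 → ℝ)) (c₀ : Fin 2 → ℝ) :
    totalVert a b (fun _ => c₀) ≤
      fibreTotal a b + fibreTotal b (fun _ => c₀) + fibreTotal (fun _ => c₀) a + C * Fintype.card G := by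
  have h := totalVert_const_le_fibreTotal a b c₀
  omega

/-! ### The three-system locator -/

/-- **`T ≤ |G|·min(V_P, V_Q, V_R) + |G|²`**: by memo L1 through each of the three pair systems.  So the weak law can only fail
if all three fibre totals are super-linear. [folklore] -/
theorem totalVert_le_card_mul_min (a b c : G → (Fin 2 → ℝ)) :
    totalVert a b c ≤
      Fintype.card G * min (fibreTotal a b) (min (fibreTotal b c) (fibreTotal c a)) + Fintype.card G ^ 2 := by
  have hP : totalVert a b c ≤ Fintype.card G * fibreTotal a b + Fintype.card G ^ 2 := by
    have := totalVert_le_card_mul a b c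
    rw [mul_add, ← sq] at this
    exact this
  have hQ : totalVert a b c ≤ Fintype.card G * fibreTotal b c + Fintype.card G ^ 2 := by
    unfold totalVert
    calc ∑ s, classVert a b c s ≤ ∑ _s : G, (fibreTotal b c + Fintype.card G) :=
          Finset.sum_le_sum fun s _ => classVert_le_fibreTotal_bc_add_card a b c s
      _ = Fintype.card G * fibreTotal b c + Fintype.card G ^ 2 := by
          rw [Finset.sum_const, Finset.card_univ, smul_eq_mul]; ring
  have hR : totalVert a b c ≤ Fintype.card G * fibreTotal c a + Fintype.card G ^ 2 := by
    unfold totalVert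
    calc ∑ s, classVert a b c s ≤ ∑ _s : G, (fibreTotal c a + Fintype.card G) :=
          Finset.sum_le_sum fun s _ => classVert_le_fibreTotal_ca_add_card a b c s
      _ = Fintype.card G * fibreTotal c a + Fintype.card G ^ 2 := by
          rw [Finset.sum_const, Finset.card_univ, smul_eq_mul]; ring
  rcases le_total (fibreTotal a b) (min (fibreTotal b c) (fibreTotal c a)) with h1 | h1
  · rw [min_eq_left h1]; exact hP
  · rw [min_eq_right h1]
    rcases le_total (fibreTotal b c) (fibreTotal c a) with h2 | h2
    · rw [min_eq_left h2]; exact hQ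
    · rw [min_eq_right h2]; exact hR

end TotalsLaw

end Summit.ValiantsHypothesis.ValiantsHypothesis.Theorems.NewtonUnitEquationsDissociatedUniform
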